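import Literature.Geometry.Manifold.InjOnLocalDiffeomorphInverse
import Mathlib.Geometry.Manifold.MFDeriv.Basic
import Mathlib.Geometry.Manifold.MFDeriv.FDeriv
import Mathlib.Geometry.Manifold.ContMDiff.NormedSpace
import Mathlib.Geometry.Manifold.Instances.Real
import Mathlib.Analysis.Complex.Basic
import Mathlib.LinearAlgebra.Complex.FiniteDimensional

/-!
# The leaf coordinate of an HLS family of two-chart spheres
(registered helper `helper_foliationCoordinate` of line `cross-cap-laurent`, crux
`GromovRecognitionRelEnd`, item stmt-SmoothPoincare4-11009)

The local-foliation fact (Hofer–Lizan–Sikorav / Wendl, Prop. 2.53, vendored as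
`Literature.Geometry.Symplectic.hls_localFoliation_embeddedSphere_trivialNormal`) hands the lead a
one-complex-parameter family of embedded spheres in a `4`-manifold `X`, each presented as a
*two-chart pair* `(U a, V a)`, `‖a‖ < ε` (`V a z = U a z⁻¹` for `z ≠ 0`), jointly smooth in `(a, z)`
on `ball 0 ε × ℂ`, with pairwise DISJOINT images `range (U a) ∪ {V a 0}` (the *leaves*), injective
differentials of the two uncurried maps `Φ (a, z) = U a z`, `Ψ (a, w) = V a w`, sweeping out the
set `N = ⋃ a ∈ ball 0 ε, (range (U a) ∪ {V a 0})`.  This file proves `helper_foliationCoordinate`: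
the LEAF COORDINATE `π : X → ℂ` (`π y =` the parameter of the leaf through `y`, junk `0` off `N`;
well defined by disjointness) is `C^∞` and submersive on `N`, equals `a` on the leaf `a` (so its
level sets in `N` are exactly the leaves), and `ker dπ_y` is the tangent of the leaf through `y`.

Proof.  Every point of `N` is `Φ q` or `Ψ q` with `q ∈ s := ball 0 ε ×ˢ univ` (a point `V a w`,
`w ≠ 0`, is `U a w⁻¹`).  Both `Φ` and `Ψ` are injective on the open set `s` (two parameters with a
common image point are equal, by applying `π`; then use injectivity of `U a`, resp. of `V a`, the
latter from `V a w = U a w⁻¹` and `V a 0 ∉ range (U a)`), `C^∞` there, with injective — hence, as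
`ℂ × ℂ` and `ℝ⁴` both have real dimension `4`, bijective — differentials.  By the tree's manifold
inverse-function-theorem kit (`Literature.Geometry.Manifold.contMDiffAt_invFunOn_of_bijective_mfderiv`,
`isOpen_image_of_bijective_mfderiv`) the inverse `invFunOn Φ s` is `C^∞` on the open image
`Φ '' s`, where `π = Prod.fst ∘ invFunOn Φ s`; so `π` is `C^∞` near `Φ q`, and the chain rule for
`π ∘ Φ = Prod.fst` (near `q`) gives `dπ (dΦ v) = v.1`: `dπ` is onto, and, `dΦ_q` being onto,
`dπ ξ = 0` iff `ξ = dΦ (0, ζ) = d(U a)_z ζ` for some `ζ` (`U a = Φ ∘ (a, ·)`).  Same for `Ψ`.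

References: C. Wendl, *Holomorphic Curves in Low Dimensions* (2018), Prop. 2.53; J. M. Lee,
*Introduction to Smooth Manifolds*, 2nd ed. (2013), Thm. 4.5 (inverse function theorem).
-/

-- the prescribed namespace `Summit.<P>.<Sub>.…` duplicates `SmoothPoincare4` (P = Sub)
set_option linter.dupNamespace false

open Set Function
open scoped Manifold ContDiff Topology
open Literature.Geometry.Manifold

namespace Summit.SmoothPoincare4.SmoothPoincare4.Theorems.GromovRecognitionRelEnd.CrossCapLaurent

namespace FoliationCoordinate

variable {X : Type} [TopologicalSpace X] [ChartedSpace (EuclideanSpace ℝ (Fin 4)) X]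

/-- An injective real-linear map `ℂ × ℂ → ℝ⁴` is bijective (both spaces have real dimension `4`).
[folklore] -/
theorem bijective_of_injective_real4 (L : ℂ × ℂ →L[ℝ] EuclideanSpace ℝ (Fin 4))
    (hL : Injective L) : Bijective L := by
  refine ⟨hL, ?_⟩
  have h4 : Module.finrank ℝ (ℂ × ℂ) = Module.finrank ℝ (EuclideanSpace ℝ (Fin 4)) := by
    simp [Complex.finrank_real_complex]
  exact (LinearMap.injective_iff_surjective_of_finrank_eq_finrank h4).1 hL

/-- **Differential of a partial map.**  For `F : ℂ × ℂ → X` differentiable at `(a, z)`, the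
differential of `w ↦ F (a, w)` at `z` is `ζ ↦ dF_(a, z) (0, ζ)` (chain rule with the affine map
`w ↦ (a, w)`, whose differential is `ContinuousLinearMap.inr`). [folklore] -/
theorem mfderiv_curry_apply (F : ℂ × ℂ → X) {a z : ℂ}
    (hF : MDifferentiableAt 𝓘(ℝ, ℂ × ℂ) (𝓡 4) F (a, z)) (ζ : ℂ) :
    mfderiv 𝓘(ℝ, ℂ) (𝓡 4) (fun w => F (a, w)) z ζ =
      mfderiv 𝓘(ℝ, ℂ × ℂ) (𝓡 4) F (a, z) ((0 : ℂ), ζ) := by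
  have hi : HasMFDerivAt 𝓘(ℝ, ℂ) 𝓘(ℝ, ℂ × ℂ) (fun w : ℂ => (a, w)) z
      (ContinuousLinearMap.inr ℝ ℂ ℂ) :=
    (hasFDerivAt_prodMk_right a z).hasMFDerivAt
  have h := hF.hasMFDerivAt.comp z hi
  rw [show (fun w => F (a, w)) = F ∘ fun w => (a, w) from rfl, h.mfderiv]
  rfl

variable [IsManifold (𝓡 4) ∞ X]

/-- **A left inverse coordinate of an injective local diffeomorphism is smooth, with the first
projection as differential.**  Let `F : ℂ × ℂ → X` be `C^∞` and injective on an open set `s` with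
bijective differential at every point of `s`, and let `π : X → ℂ` satisfy `π (F q) = q.1` for
`q ∈ s`.  Then at every `q ∈ s`, `π` is `C^∞` at `F q` (near `F q` it is `Prod.fst ∘ invFunOn F s`,
smooth by the inverse function theorem) and `dπ_(F q) (dF_q v) = v.1` (chain rule for
`π ∘ F = Prod.fst` near `q`). [folklore] -/
theorem contMDiffAt_and_mfderiv_of_apply_eq_fst {F : ℂ × ℂ → X} {s : Set (ℂ × ℂ)} {π : X → ℂ}
    (hs : IsOpen s) (hF : ContMDiffOn 𝓘(ℝ, ℂ × ℂ) (𝓡 4) ∞ F s) (hinj : InjOn F s)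
    (hbij : ∀ q ∈ s, Bijective (mfderiv 𝓘(ℝ, ℂ × ℂ) (𝓡 4) F q))
    (hπ : ∀ q ∈ s, π (F q) = q.1) {q : ℂ × ℂ} (hq : q ∈ s) :
    ContMDiffAt (𝓡 4) 𝓘(ℝ, ℂ) ∞ π (F q) ∧
      ∀ v : ℂ × ℂ,
        mfderiv (𝓡 4) 𝓘(ℝ, ℂ) π (F q) (mfderiv 𝓘(ℝ, ℂ × ℂ) (𝓡 4) F q v) = v.1 := by
  -- `π = Prod.fst ∘ invFunOn F s` on the open image `F '' s`
  have hO : IsOpen (F '' s) := isOpen_image_of_bijective_mfderiv hs hF hbij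
  have hev : π =ᶠ[𝓝 (F q)] (Prod.fst ∘ invFunOn F s) := by
    filter_upwards [hO.mem_nhds ⟨q, hq, rfl⟩]
    rintro _ ⟨p, hp, rfl⟩
    rw [Function.comp_apply, invFunOn_apply hinj hp, hπ p hp]
  have hfst : ContMDiff 𝓘(ℝ, ℂ × ℂ) 𝓘(ℝ, ℂ) ∞ (Prod.fst : ℂ × ℂ → ℂ) := contDiff_fst.contMDiff
  have hG : ContMDiffAt (𝓡 4) 𝓘(ℝ, ℂ × ℂ) ∞ (invFunOn F s) (F q) :=
    contMDiffAt_invFunOn_of_bijective_mfderiv hs hF hinj hbij hq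
  have hπs : ContMDiffAt (𝓡 4) 𝓘(ℝ, ℂ) ∞ π (F q) :=
    (hfst.contMDiffAt.comp (F q) hG).congr_of_eventuallyEq hev
  refine ⟨hπs, fun v => ?_⟩
  -- chain rule for `π ∘ F = Prod.fst` near `q`
  have hFd : MDifferentiableAt 𝓘(ℝ, ℂ × ℂ) (𝓡 4) F q :=
    (hF.contMDiffAt (hs.mem_nhds hq)).mdifferentiableAt (by simp)
  have hπd : MDifferentiableAt (𝓡 4) 𝓘(ℝ, ℂ) π (F q) := hπs.mdifferentiableAt (by simp)
  have h1 : HasMFDerivAt 𝓘(ℝ, ℂ × ℂ) 𝓘(ℝ, ℂ) (π ∘ F) q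
      ((mfderiv (𝓡 4) 𝓘(ℝ, ℂ) π (F q)).comp (mfderiv 𝓘(ℝ, ℂ × ℂ) (𝓡 4) F q)) :=
    hπd.hasMFDerivAt.comp q hFd.hasMFDerivAt
  have h2 : HasMFDerivAt 𝓘(ℝ, ℂ × ℂ) 𝓘(ℝ, ℂ) (π ∘ F) q (ContinuousLinearMap.fst ℝ ℂ ℂ) := by
    have h : HasMFDerivAt 𝓘(ℝ, ℂ × ℂ) 𝓘(ℝ, ℂ) (Prod.fst : ℂ × ℂ → ℂ) q
        (ContinuousLinearMap.fst ℝ ℂ ℂ) :=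
      (hasFDerivAt_fst (𝕜 := ℝ) (p := q)).hasMFDerivAt
    refine h.congr_of_eventuallyEq ?_
    filter_upwards [hs.mem_nhds hq] with p hp
    exact hπ p hp
  exact DFunLike.congr_fun (hasMFDerivAt_unique h1 h2) v

/-- **Kernel of the coordinate differential.**  In the situation of
`contMDiffAt_and_mfderiv_of_apply_eq_fst`, at a point `F (a, z)`, `(a, z) ∈ s`, a tangent vector
`ξ` is killed by `dπ` iff it is tangent to the slice `w ↦ F (a, w)` at `z`: write `ξ = dF_(a,z) v`
(`dF` is onto); then `dπ ξ = v.1`, and `dF_(a,z) (0, ζ) = d(F (a, ·))_z ζ`. [folklore] -/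
theorem mfderiv_apply_eq_zero_iff_of_apply_eq_fst {F : ℂ × ℂ → X} {s : Set (ℂ × ℂ)} {π : X → ℂ}
    (hs : IsOpen s) (hF : ContMDiffOn 𝓘(ℝ, ℂ × ℂ) (𝓡 4) ∞ F s) (hinj : InjOn F s)
    (hbij : ∀ q ∈ s, Bijective (mfderiv 𝓘(ℝ, ℂ × ℂ) (𝓡 4) F q))
    (hπ : ∀ q ∈ s, π (F q) = q.1) {a z : ℂ} (hq : (a, z) ∈ s)
    (ξ : TangentSpace (𝓡 4) (F (a, z))) :
    mfderiv (𝓡 4) 𝓘(ℝ, ℂ) π (F (a, z)) ξ = 0 ↔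
      ξ ∈ range (mfderiv 𝓘(ℝ, ℂ) (𝓡 4) (fun w => F (a, w)) z) := by
  have key := (contMDiffAt_and_mfderiv_of_apply_eq_fst hs hF hinj hbij hπ hq).2
  have hcur : ∀ ζ : ℂ, mfderiv 𝓘(ℝ, ℂ) (𝓡 4) (fun w => F (a, w)) z ζ =
      mfderiv 𝓘(ℝ, ℂ × ℂ) (𝓡 4) F (a, z) ((0 : ℂ), ζ) :=
    mfderiv_curry_apply F ((hF.contMDiffAt (hs.mem_nhds hq)).mdifferentiableAt (by simp))
  constructor
  · intro hξ
    obtain ⟨v, rfl⟩ : ∃ v : ℂ × ℂ, mfderiv 𝓘(ℝ, ℂ × ℂ) (𝓡 4) F (a, z) v = ξ := (hbij _ hq).2 ξ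
    have hv : v.1 = 0 := ((key v).symm.trans hξ)
    refine ⟨v.2, ?_⟩
    rw [hcur, show ((0 : ℂ), v.2) = v from Prod.ext hv.symm rfl]
  · rintro ⟨ζ, rfl⟩
    rw [hcur]
    exact key ((0 : ℂ), ζ)

end FoliationCoordinate

open FoliationCoordinate

/-- **The leaf coordinate of an HLS family.**  Let `(U a, V a)`, `‖a‖ < ε`, be a family of
two-chart spheres (`V a z = U a z⁻¹` for `z ≠ 0`, `U a` injective, `V a 0 ∉ range (U a)`) in a
`4`-manifold `X`, jointly `C^∞` in `(a, z)` on `ball 0 ε × ℂ`, with pairwise disjoint leaves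
`range (U a) ∪ {V a 0}` and injective differentials of the uncurried maps `(a, z) ↦ U a z`,
`(a, w) ↦ V a w` on `ball 0 ε × ℂ`.  Then there is `π : X → ℂ`, `C^∞` and submersive on the swept
set `N = ⋃ a ∈ ball 0 ε, (range (U a) ∪ {V a 0})`, with `π (U a z) = a`, `π (V a w) = a`, level
sets `{y ∈ N | π y = a} = range (U a) ∪ {V a 0}`, and `ker dπ` at `U a z` (resp. `V a w`) equal to
the range of `d(U a)_z` (resp. `d(V a)_w`). -/
theorem helper_foliationCoordinate : ∀ (X : Type) [TopologicalSpace X] [T2Space X]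
    [SecondCountableTopology X] [ChartedSpace (EuclideanSpace ℝ (Fin 4)) X] [IsManifold (𝓡 4) ∞ X]
    (ε : ℝ) (U V : ℂ → ℂ → X), 0 < ε →
    (∀ a : ℂ, ‖a‖ < ε →
      ContMDiff 𝓘(ℝ, ℂ) (𝓡 4) ∞ (U a) ∧ ContMDiff 𝓘(ℝ, ℂ) (𝓡 4) ∞ (V a) ∧
      (∀ z : ℂ, z ≠ 0 → V a z = U a z⁻¹) ∧
      Injective (U a) ∧ (∀ z, Injective (mfderiv 𝓘(ℝ, ℂ) (𝓡 4) (U a) z)) ∧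
      Injective (mfderiv 𝓘(ℝ, ℂ) (𝓡 4) (V a) 0) ∧ V a 0 ∉ range (U a)) →
    ContMDiffOn 𝓘(ℝ, ℂ × ℂ) (𝓡 4) ∞ (fun q : ℂ × ℂ => U q.1 q.2) (Metric.ball 0 ε ×ˢ univ) →
    ContMDiffOn 𝓘(ℝ, ℂ × ℂ) (𝓡 4) ∞ (fun q : ℂ × ℂ => V q.1 q.2) (Metric.ball 0 ε ×ˢ univ) →
    (∀ a a' : ℂ, ‖a‖ < ε → ‖a'‖ < ε → a ≠ a' →
      Disjoint (range (U a) ∪ {V a 0}) (range (U a') ∪ {V a' 0})) →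
    (∀ q ∈ Metric.ball (0 : ℂ) ε ×ˢ (univ : Set ℂ),
      Injective (mfderiv 𝓘(ℝ, ℂ × ℂ) (𝓡 4) (fun q : ℂ × ℂ => U q.1 q.2) q) ∧
      Injective (mfderiv 𝓘(ℝ, ℂ × ℂ) (𝓡 4) (fun q : ℂ × ℂ => V q.1 q.2) q)) →
    IsOpen (⋃ a ∈ Metric.ball (0 : ℂ) ε, (range (U a) ∪ {V a 0})) →
    ∃ π : X → ℂ,
      ContMDiffOn (𝓡 4) 𝓘(ℝ, ℂ) ∞ π (⋃ a ∈ Metric.ball (0 : ℂ) ε, (range (U a) ∪ {V a 0})) ∧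
      (∀ y ∈ ⋃ a ∈ Metric.ball (0 : ℂ) ε, (range (U a) ∪ {V a 0}),
        Surjective (mfderiv (𝓡 4) 𝓘(ℝ, ℂ) π y)) ∧
      (∀ a : ℂ, ‖a‖ < ε → ∀ z : ℂ, π (U a z) = a) ∧
      (∀ a : ℂ, ‖a‖ < ε → ∀ w : ℂ, π (V a w) = a) ∧
      (∀ a : ℂ, ‖a‖ < ε →
        {y | y ∈ (⋃ a' ∈ Metric.ball (0 : ℂ) ε, (range (U a') ∪ {V a' 0})) ∧ π y = a} =
          range (U a) ∪ {V a 0}) ∧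
      (∀ a : ℂ, ‖a‖ < ε → ∀ (z : ℂ) (ξ : TangentSpace (𝓡 4) (U a z)),
        mfderiv (𝓡 4) 𝓘(ℝ, ℂ) π (U a z) ξ = 0 ↔
          ξ ∈ range (mfderiv 𝓘(ℝ, ℂ) (𝓡 4) (U a) z)) ∧
      (∀ a : ℂ, ‖a‖ < ε → ∀ (w : ℂ) (ξ : TangentSpace (𝓡 4) (V a w)),
        mfderiv (𝓡 4) 𝓘(ℝ, ℂ) π (V a w) ξ = 0 ↔
          ξ ∈ range (mfderiv 𝓘(ℝ, ℂ) (𝓡 4) (V a) w)) := by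
  intro X _ _ _ _ _ ε U V _ hleaf hU hV hdisj hinjd _
  -- every `V a w` lies on the leaf `a`
  have hVmem : ∀ a : ℂ, ‖a‖ < ε → ∀ w : ℂ, V a w ∈ range (U a) ∪ {V a 0} := by
    intro a ha w
    by_cases hw : w = 0
    · rw [hw]
      exact Or.inr rfl
    · exact Or.inl ⟨w⁻¹, ((hleaf a ha).2.2.1 w hw).symm⟩
  -- each `V a` is injective (`V a w = U a w⁻¹` off `0`, and `V a 0 ∉ range (U a)`)
  have hVinj : ∀ a : ℂ, ‖a‖ < ε → Injective (V a) := by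
    intro a ha w w' h
    obtain ⟨-, -, hVU, hUinj, -, -, hV0⟩ := hleaf a ha
    by_cases hw : w = 0
    · by_cases hw' : w' = 0
      · rw [hw, hw']
      · subst hw
        exact absurd ⟨w'⁻¹, by rw [h, hVU w' hw']⟩ hV0
    · by_cases hw' : w' = 0
      · subst hw'
        exact absurd ⟨w⁻¹, by rw [← h, hVU w hw]⟩ hV0
      · rw [hVU w hw, hVU w' hw'] at h
        exact inv_inj.1 (hUinj h)
  -- the leaf coordinate: `π y = a` for `y` on the leaf `a`, well defined by disjointness
  obtain ⟨π, hπ⟩ : ∃ π : X → ℂ, ∀ a : ℂ, ‖a‖ < ε → ∀ y ∈ range (U a) ∪ {V a 0}, π y = a := by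
    classical
    refine ⟨fun y => if h : ∃ a : ℂ, ‖a‖ < ε ∧ y ∈ range (U a) ∪ {V a 0} then h.choose else 0,
      fun a ha y hy => ?_⟩
    have h : ∃ a : ℂ, ‖a‖ < ε ∧ y ∈ range (U a) ∪ {V a 0} := ⟨a, ha, hy⟩
    simp only [dif_pos h]
    by_contra hne
    exact Set.disjoint_left.1 (hdisj _ _ h.choose_spec.1 ha hne) h.choose_spec.2 hy
  have hπU : ∀ a : ℂ, ‖a‖ < ε → ∀ z : ℂ, π (U a z) = a :=
    fun a ha z => hπ a ha _ (Or.inl ⟨z, rfl⟩)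
  have hπV : ∀ a : ℂ, ‖a‖ < ε → ∀ w : ℂ, π (V a w) = a :=
    fun a ha w => hπ a ha _ (hVmem a ha w)
  -- the parameter domain `s = ball 0 ε × ℂ`
  have hs : IsOpen (Metric.ball (0 : ℂ) ε ×ˢ (univ : Set ℂ)) := Metric.isOpen_ball.prod isOpen_univ
  have hmem : ∀ q : ℂ × ℂ, q ∈ Metric.ball (0 : ℂ) ε ×ˢ (univ : Set ℂ) ↔ ‖q.1‖ < ε := fun q => by
    simp
  -- `π ∘ Φ = Prod.fst = π ∘ Ψ` on `s`
  have hπΦ : ∀ q ∈ Metric.ball (0 : ℂ) ε ×ˢ (univ : Set ℂ), π (U q.1 q.2) = q.1 :=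
    fun q hq => hπU q.1 ((hmem q).1 hq) q.2
  have hπΨ : ∀ q ∈ Metric.ball (0 : ℂ) ε ×ˢ (univ : Set ℂ), π (V q.1 q.2) = q.1 :=
    fun q hq => hπV q.1 ((hmem q).1 hq) q.2
  -- `Φ`, `Ψ` are injective on `s`
  have hinjΦ : InjOn (fun q : ℂ × ℂ => U q.1 q.2) (Metric.ball (0 : ℂ) ε ×ˢ (univ : Set ℂ)) := by
    intro q hq q' hq' h
    dsimp only at h
    have h1 : q.1 = q'.1 := by
      have e := congrArg π h
      rwa [hπΦ q hq, hπΦ q' hq'] at e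
    refine Prod.ext h1 ((hleaf q.1 ((hmem q).1 hq)).2.2.2.1 ?_)
    rw [h, h1]
  have hinjΨ : InjOn (fun q : ℂ × ℂ => V q.1 q.2) (Metric.ball (0 : ℂ) ε ×ˢ (univ : Set ℂ)) := by
    intro q hq q' hq' h
    dsimp only at h
    have h1 : q.1 = q'.1 := by
      have e := congrArg π h
      rwa [hπΨ q hq, hπΨ q' hq'] at e
    refine Prod.ext h1 (hVinj q.1 ((hmem q).1 hq) ?_)
    rw [h, h1]
  -- and have bijective differentials there (injective, equal dimensions)
  have hbijΦ : ∀ q ∈ Metric.ball (0 : ℂ) ε ×ˢ (univ : Set ℂ),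
      Bijective (mfderiv 𝓘(ℝ, ℂ × ℂ) (𝓡 4) (fun q : ℂ × ℂ => U q.1 q.2) q) :=
    fun q hq => bijective_of_injective_real4 _ (hinjd q hq).1
  have hbijΨ : ∀ q ∈ Metric.ball (0 : ℂ) ε ×ˢ (univ : Set ℂ),
      Bijective (mfderiv 𝓘(ℝ, ℂ × ℂ) (𝓡 4) (fun q : ℂ × ℂ => V q.1 q.2) q) :=
    fun q hq => bijective_of_injective_real4 _ (hinjd q hq).2
  -- every point of `N` is `Φ q` or `Ψ q` with `q ∈ s`
  have hcover : ∀ y ∈ ⋃ a ∈ Metric.ball (0 : ℂ) ε, (range (U a) ∪ {V a 0}),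
      ∃ q ∈ Metric.ball (0 : ℂ) ε ×ˢ (univ : Set ℂ),
        (fun q : ℂ × ℂ => U q.1 q.2) q = y ∨ (fun q : ℂ × ℂ => V q.1 q.2) q = y := by
    intro y hy
    obtain ⟨a, ha, hy⟩ := mem_iUnion₂.1 hy
    have ha' : ‖a‖ < ε := mem_ball_zero_iff.1 ha
    rcases hy with ⟨z, rfl⟩ | hy
    · exact ⟨(a, z), (hmem _).2 ha', Or.inl rfl⟩
    · rw [mem_singleton_iff] at hy
      exact ⟨(a, 0), (hmem _).2 ha', Or.inr hy.symm⟩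
  -- the local analysis at `Φ q` and at `Ψ q`
  have keyΦ := fun q (hq : q ∈ Metric.ball (0 : ℂ) ε ×ˢ (univ : Set ℂ)) =>
    contMDiffAt_and_mfderiv_of_apply_eq_fst hs hU hinjΦ hbijΦ hπΦ hq
  have keyΨ := fun q (hq : q ∈ Metric.ball (0 : ℂ) ε ×ˢ (univ : Set ℂ)) =>
    contMDiffAt_and_mfderiv_of_apply_eq_fst hs hV hinjΨ hbijΨ hπΨ hq
  refine ⟨π, ?_, ?_, hπU, hπV, ?_, ?_, ?_⟩
  · -- `C^∞` on `N`
    intro y hy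
    obtain ⟨q, hq, rfl | rfl⟩ := hcover y hy
    · exact (keyΦ q hq).1.contMDiffWithinAt
    · exact (keyΨ q hq).1.contMDiffWithinAt
  · -- submersive on `N`: `dπ (dΦ (c, 0)) = c`
    intro y hy c
    obtain ⟨q, hq, rfl | rfl⟩ := hcover y hy
    · exact ⟨_, (keyΦ q hq).2 (c, 0)⟩
    · exact ⟨_, (keyΨ q hq).2 (c, 0)⟩
  · -- level sets are the leaves
    intro a ha
    ext y
    simp only [mem_setOf_eq]
    constructor
    · rintro ⟨hyN, rfl⟩
      obtain ⟨a', ha', hy'⟩ := mem_iUnion₂.1 hyN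
      rwa [hπ a' (mem_ball_zero_iff.1 ha') y hy']
    · exact fun hy => ⟨mem_iUnion₂.2 ⟨a, mem_ball_zero_iff.2 ha, hy⟩, hπ a ha y hy⟩
  · -- kernel at `U a z = Φ (a, z)`
    intro a ha z ξ
    exact mfderiv_apply_eq_zero_iff_of_apply_eq_fst hs hU hinjΦ hbijΦ hπΦ ((hmem (a, z)).2 ha) ξ
  · -- kernel at `V a w = Ψ (a, w)`
    intro a ha w ξ
    exact mfderiv_apply_eq_zero_iff_of_apply_eq_fst hs hV hinjΨ hbijΨ hπΨ ((hmem (a, w)).2 ha) ξ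

end Summit.SmoothPoincare4.SmoothPoincare4.Theorems.GromovRecognitionRelEnd.CrossCapLaurent
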